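import Literature.NumberTheory.NumberFields.AmbiguousClassNumberInequality
import Literature.NumberTheory.NumberFields.CyclicExtensionClassGroupRankBound
import Literature.NumberTheory.IwasawaTheory.ClassicalMuVanishesIffBoundedRank
import Literature.NumberTheory.IwasawaTheory.ClassicalMuVanishesUnitNormIndexGenerated
import HarnessLib

/-!
# Iwasawa's `μ = 0` ASCENDS a quadratic extension `K'/K` at `ℓ = 2` when the unit signatures of the layers `K·F_n` are onto
# (totally complex `K'`, boundedly many ramified primes): the `ℓ = 2` ascent with REAL places (proved; no definition, no named fact)

`Proofs`-style file (theorems only) in topic `NumberTheory/IwasawaTheory` (namespace `Literature.NumberTheory.IwasawaTheory`), written by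
the prover seat `cruxlead-stmt-BirchSwinnertonDyer-19573-w2` GEN 7 (cell `bsd-2adic`; `--supports` stmt-BirchSwinnertonDyer-19573; closes
nothing). Module (T) of the seat's «Iwasawa ℓ = 2 ascent with real places»; modules (G) `CyclicExtensionClassGroupRankBound` and (L)
`AmbiguousClassNumberInequality` supply the finite-level steps.

THE THEOREM (`classicalMuVanishes_restrict_of_quadratic_of_signVec_surjective`). `F` a number field, `κ` a `ℤ₂`-extension of `F` (layers
`F_n ⊆ F̄`), `K ⊆ K'` number fields over `F` with `[K' : K] = 2`, `K'` TOTALLY COMPLEX, both linearly disjoint from `F_∞` (`κ ∘ res` onto),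
`j' : K' → F̄` an `F`-embedding, `j = j'|_K`; the `n`-th layers of the restricted towers are (`ClassicalMuVanishesSubextension`) the fields
`A_n = j(K)·F_n ⊆ B_n = j'(K')·F_n ⊆ F̄`, a quadratic extension of number fields with `B_n` totally complex. HYPOTHESES, for every `n`:
(i) at most `T` primes of `A_n` ramify in `B_n`; (ii) the unit signature map of `A_n` is ONTO `𝔽₂^{r₁(A_n)}` (units of every sign pattern at
the real places of `A_n` — e.g. `F = ℚ`, `K` a cubic field with one real place: the real places of `ℚ(P)·ℚ_n` are those of `ℚ_n`, whose units
take every signature). CONCLUSION: `ClassicalMuVanishes (κ|_K) ⟹ ClassicalMuVanishes (κ|_{K'})` (growth form of Iwasawa's `μ = 0`).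

PROOF (finite level, no `Λ`-modules): `μ(κ|_K) = 0` bounds the `2`-ranks `rank₂ Cl(A_n) ≤ R` (tree
`exists_forall_classGroupPRank_le_of_classicalMuVanishes`); per layer, Chevalley's ambiguous class number formula with the archimedean factor
`2^{r₁(A_n)}` cancelled by the unit signature index (module (L)
`padicValNat_two_card_fixed_add_one_le_of_signVec_surjective`) gives `ord₂ #Cl(B_n)^G ≤ ord₂ h(A_n) + T`, and the group-theoretic module (G)
(`CyclicRankBound.padicValNat_card_quotient_le_of_fixed`, with `N ∘ i = 2` and the ambiguity of extended classes) turns this into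
`rank₂ Cl(B_n) ≤ 2·(2R + T)`; bounded `2`-ranks give `μ(κ|_{K'}) = 0` (tree `classicalMuVanishes_of_forall_classGroupPRank_le`). This is
Iwasawa's Theorem 2/3 of 1973 at `ℓ = 2` with the proviso «`k` totally imaginary» replaced by hypothesis (ii) — the one situation with real
places of `K` in which the printed argument survives (`SCOPE-LIM2-DOWN` §3(c), cell bsd-2adic).

* §1 transport: `natCard_quotient_range_pow_eq_of_mulEquiv`, `classGroupPRank_restrict_eq`.
* §2 `natCard_fixed_eq_natCard_eqLocus_of_generator` — for `G = ⟨σ⟩`, «fixed by every `τ`» = «fixed by `σ`».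
* §3 **`classicalMuVanishes_restrict_of_quadratic_of_signVec_surjective`**.

References: [Iwasawa1973MuInvariants] K. Iwasawa, *On the μ-invariants of ℤ_ℓ-extensions* (1973), Thm. 2 and Thm. 3 («let `k` be
totally imaginary if `ℓ = 2`»), §4 (`k′ = k(√−1)`); [Washington1997] §13.1, §13.3 Prop. 13.23; [Lang1990] Ch. 13 §4 Lemma 4.1;
[Gras2003] IV.4; [NeukirchANT1999] Ch. III §1 Prop. (1.6) (ii), (iv).
-/

set_option autoImplicit false

noncomputable section

open scoped NumberField Classical
open NumberField Field IntermediateField IsDedekindDomain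

namespace Literature.NumberTheory.IwasawaTheory

open Literature.NumberTheory.EllipticCurves Literature.NumberTheory.EllipticCurves.ZpExtension
  Literature.NumberTheory.GaloisRepresentations Literature.NumberTheory.NumberFields
  Literature.NumberTheory.NumberFields.AmbiguousClass Literature.NumberTheory.NumberFields.CyclicRankBound
  Literature.Geometry.Kaehler.ComplexTorus

variable {F : Type} [Field F] [NumberField F]

/-! ## §1 Transport of `rank_p Cl` along the layer isomorphism -/

/-- `#(G / Gⁿ) = #(H / Hⁿ)` along a group isomorphism `G ≃* H`. [folklore] -/
private theorem natCard_quotient_range_pow_eq_of_mulEquiv {G H : Type*} [CommGroup G] [CommGroup H] (e : G ≃* H) (n : ℕ) :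
    Nat.card (G ⧸ (powMonoidHom n : G →* G).range) = Nat.card (H ⧸ (powMonoidHom n : H →* H).range) := by
  have hmap : ((powMonoidHom n : G →* G).range).map e.toMonoidHom = (powMonoidHom n : H →* H).range := by
    ext h
    constructor
    · rintro ⟨g, ⟨x, rfl⟩, rfl⟩
      exact ⟨e x, by rw [powMonoidHom_apply, powMonoidHom_apply, MulEquiv.coe_toMonoidHom, map_pow]⟩
    · rintro ⟨y, rfl⟩
      refine ⟨(e.symm y) ^ n, ⟨e.symm y, rfl⟩, ?_⟩
      rw [MulEquiv.coe_toMonoidHom, map_pow, MulEquiv.apply_symm_apply, powMonoidHom_apply]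
  exact Nat.card_congr (QuotientGroup.congr _ _ e hmap).toEquiv

/-- **`rank_p Cl((M·F_∞)_n) = rank_p Cl(j(M)·F_n)`**: the `p`-rank of the class group of the `n`-th layer of the restricted tower is that
of the compositum `j(M)·F_n ⊆ F̄` (class groups along the ring isomorphism of `ZpExtensionRestrictLayerCompositum`).
[cite: Washington1997, §13.1] -/
theorem classGroupPRank_restrict_eq {p : ℕ} [Fact p.Prime] (κ : ZpExtension F p) (M : Type) [Field M] [NumberField M]
    [Algebra F M] (h : Function.Surjective (κ.toContinuousMonoidHom.comp (absGaloisRestrict F M)))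
    (j : M →ₐ[F] AlgebraicClosure F) (n : ℕ) :
    classGroupPRank (κ.restrict M h) n =
      padicValNat p (Nat.card (ClassGroup (𝓞 ↥(j.fieldRange ⊔ κ.layer n)) ⧸
        (powMonoidHom p : ClassGroup (𝓞 ↥(j.fieldRange ⊔ κ.layer n)) →* _).range)) := by
  obtain ⟨e⟩ := nonempty_ringEquiv_layer_restrict_fieldRange_sup_layer κ M h j n
  rw [classGroupPRank_def,
    natCard_quotient_range_pow_eq_of_mulEquiv (ClassGroup.mulEquiv (NumberField.RingOfIntegers.mapRingEquiv e)) p]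

/-! ## §2 Ambiguous classes of a cyclic group: fixed by a generator -/

/-- For `G = ⟨σ⟩` acting on a commutative group through `φ` (`φ 1 = 1`, `φ (ab) = φ b` then `φ a`), a class is fixed by every `τ ∈ G` iff it
is fixed by `σ`; hence the two fixed-point counts agree. [cite: Lang1990, Ch. 13 §4 (ambiguous classes, G cyclic generated by σ)] -/
theorem natCard_fixed_eq_natCard_eqLocus_of_generator {G : Type*} [Group G] {X : Type*} [CommGroup X] (φ : G → X ≃* X)
    (hφ1 : φ 1 = MulEquiv.refl X) (hφmul : ∀ a b : G, φ (a * b) = (φ b).trans (φ a)) {σ : G}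
    (hσ : ∀ τ : G, τ ∈ Subgroup.zpowers σ) :
    Nat.card {c : X // ∀ τ : G, φ τ c = c} = Nat.card ((φ σ).toMonoidHom.eqLocus (MonoidHom.id X)) := by
  refine Nat.card_congr (Equiv.subtypeEquivRight fun c ↦ ⟨fun h ↦ h σ, fun h τ ↦ ?_⟩)
  -- the stabiliser of `c` is a subgroup containing `σ`
  have hc : φ σ c = c := h
  let S : Subgroup G :=
    { carrier := {a | φ a c = c}
      one_mem' := by simp [hφ1]
      mul_mem' := fun {a b} ha hb ↦ by
        simp only [Set.mem_setOf_eq] at ha hb ⊢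
        rw [hφmul, MulEquiv.trans_apply, hb, ha]
      inv_mem' := fun {a} ha ↦ by
        simp only [Set.mem_setOf_eq] at ha ⊢
        have h1 : (φ a⁻¹).trans (φ a) = MulEquiv.refl X := by rw [← hφmul, mul_inv_cancel, hφ1]
        have h2 : φ a (φ a⁻¹ c) = c := by
          have := congrArg (fun e : X ≃* X ↦ e c) h1
          simpa using this
        exact (φ a).injective (h2.trans ha.symm) }
  have hmem : σ ∈ S := hc
  have hle : Subgroup.zpowers σ ≤ S := (Subgroup.zpowers_le).mpr hmem
  exact hle (hσ τ)

/-! ## §3 The ascent along a quadratic extension -/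

omit [NumberField F] in
/-- `j(K) ⊔ F_n ≤ j'(K') ⊔ F_n` for `j = j' ∘ (K → K')` (the layers of the restricted towers along `K ⊆ K'`, Washington §13.1).
[cite: Washington1997, §13.1 (the layers K·F_n of the restricted ℤ_p-extension)] -/
theorem fieldRange_comp_sup_layer_le {p : ℕ} [Fact p.Prime] (κ : ZpExtension F p) (K K' : Type) [Field K] [Algebra F K]
    [Field K'] [Algebra F K'] [Algebra K K'] [IsScalarTower F K K'] (j' : K' →ₐ[F] AlgebraicClosure F) (n : ℕ) :
    (j'.comp (IsScalarTower.toAlgHom F K K')).fieldRange ⊔ κ.layer n ≤ j'.fieldRange ⊔ κ.layer n := by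
  refine sup_le_sup_right ?_ _
  rintro _ ⟨x, rfl⟩
  exact ⟨IsScalarTower.toAlgHom F K K' x, rfl⟩

/-- **Iwasawa's `μ = 0` ascends a quadratic extension at `ℓ = 2` under the unit-signature hypothesis.** `κ` a `ℤ₂`-extension of the
number field `F`; `K ⊆ K'` number fields over `F`, `[K' : K] = 2`, `K'` totally complex, `κ ∘ res` onto for both (linear disjointness from
`F_∞`); `j' : K' → F̄` over `F`, `j = j'|_K`, layers `A_n = j(K)·F_n ⊆ B_n = j'(K')·F_n`. If for every `n` (i) at most `T` primes of `A_n`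
ramify in `B_n` and (ii) the unit signature map of `A_n` (`ComplexTorus.signVec`) is onto, then
`ClassicalMuVanishes (κ|_K) ⟹ ClassicalMuVanishes (κ|_{K'})`. Finite-level proof: bounded `2`-ranks downstairs (tree) ⟹ per layer
`ord₂ #Cl(B_n)^G + 1 ≤ ord₂ h(A_n) + t_n` (module (L), Chevalley with the archimedean factor absorbed by the signatures) ⟹
`rank₂ Cl(B_n) ≤ 2(2R + T)` (module (G)) ⟹ `μ = 0` upstairs (tree). [cite: Iwasawa1973MuInvariants, Thm. 2 and Thm. 3 (ℓ = 2: «k totally imaginary»; replaced here by (ii))]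
[cite: Washington1997, §13.3 Prop. 13.23] [cite: Lang1990, Ch. 13 §4 Lemma 4.1] [cite: NeukirchANT1999, Ch. III §1 Prop. (1.6) (ii), (iv)] -/
theorem classicalMuVanishes_restrict_of_quadratic_of_signVec_surjective (κ : ZpExtension F 2) (K K' : Type) [Field K]
    [NumberField K] [Algebra F K] [Field K'] [NumberField K'] [Algebra F K'] [Algebra K K'] [IsScalarTower F K K']
    [IsTotallyComplex K'] (hdeg : Module.finrank K K' = 2)
    (hK : Function.Surjective (κ.toContinuousMonoidHom.comp (absGaloisRestrict F K)))
    (hK' : Function.Surjective (κ.toContinuousMonoidHom.comp (absGaloisRestrict F K')))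
    (j' : K' →ₐ[F] AlgebraicClosure F) (T : ℕ)
    (hram : ∀ n : ℕ,
      letI : Algebra ↥((j'.comp (IsScalarTower.toAlgHom F K K')).fieldRange ⊔ κ.layer n) ↥(j'.fieldRange ⊔ κ.layer n) :=
        (IntermediateField.inclusion (fieldRange_comp_sup_layer_le κ K K' j' n)).toRingHom.toAlgebra
      {v : HeightOneSpectrum (𝓞 ↥((j'.comp (IsScalarTower.toAlgHom F K K')).fieldRange ⊔ κ.layer n)) |
        v.asIdeal.ramificationIdxIn (𝓞 ↥(j'.fieldRange ⊔ κ.layer n)) ≠ 1}.ncard ≤ T)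
    (hsig : ∀ n : ℕ, Function.Surjective
      (signVec (K := ↥((j'.comp (IsScalarTower.toAlgHom F K K')).fieldRange ⊔ κ.layer n))))
    (hμ : ClassicalMuVanishes (κ.restrict K hK)) :
    ClassicalMuVanishes (κ.restrict K' hK') := by
  haveI : Fact (Nat.Prime 2) := ⟨Nat.prime_two⟩
  haveI : FiniteDimensional F K := Module.Finite.of_restrictScalars_finite ℚ F K
  haveI : FiniteDimensional F K' := Module.Finite.of_restrictScalars_finite ℚ F K'
  haveI : FiniteDimensional K K' := Module.Finite.of_restrictScalars_finite F K K'
  -- bounded `2`-ranks downstairs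
  obtain ⟨R, hR⟩ := exists_forall_classGroupPRank_le_of_classicalMuVanishes (κ.restrict K hK) hμ
  refine classicalMuVanishes_of_forall_classGroupPRank_le (κ.restrict K' hK') (B := 2 * (2 * R + T)) fun n ↦ ?_
  -- the layers `A = j(K)·F_n ⊆ B = j'(K')·F_n`
  set j : K →ₐ[F] AlgebraicClosure F := j'.comp (IsScalarTower.toAlgHom F K K') with hj
  set A : IntermediateField F (AlgebraicClosure F) := j.fieldRange ⊔ κ.layer n with hA
  set B : IntermediateField F (AlgebraicClosure F) := j'.fieldRange ⊔ κ.layer n with hB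
  have hAB : A ≤ B := fieldRange_comp_sup_layer_le κ K K' j' n
  haveI : NumberField ↥A := numberField_fieldRange_sup_layer κ K j n
  haveI : NumberField ↥B := numberField_fieldRange_sup_layer κ K' j' n
  letI : Algebra ↥A ↥B := (IntermediateField.inclusion hAB).toRingHom.toAlgebra
  haveI : IsScalarTower F ↥A ↥B := IsScalarTower.of_algebraMap_eq fun x ↦ rfl
  haveI : Module.Free ↥A ↥B := Module.Free.of_divisionRing ↥A ↥B
  haveI : FiniteDimensional ↥A ↥B := Module.Finite.of_restrictScalars_finite F ↥A ↥B
  -- `[B : A] = [K' : K] = 2`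
  have hdA : Module.finrank F ↥A = Module.finrank F K * 2 ^ n := finrank_fieldRange_sup_layer κ K hK j n
  have hdB : Module.finrank F ↥B = Module.finrank F K' * 2 ^ n := finrank_fieldRange_sup_layer κ K' hK' j' n
  have hdegAB : Module.finrank ↥A ↥B = 2 := by
    have htower := Module.finrank_mul_finrank F ↥A ↥B
    have hKK' := Module.finrank_mul_finrank F K K'
    have hA0 : 0 < Module.finrank F ↥A := Module.finrank_pos
    have h1 : Module.finrank F ↥A * Module.finrank ↥A ↥B = Module.finrank F ↥A * 2 := by
      rw [htower, hdB, hdA, ← hKK', hdeg]; ring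
    exact Nat.eq_of_mul_eq_mul_left hA0 h1
  haveI : Algebra.IsQuadraticExtension ↥A ↥B := ⟨hdegAB⟩
  haveI : IsGalois ↥A ↥B := inferInstance
  -- `B` is totally complex (it contains a copy of `K'`)
  haveI : IsTotallyComplex ↥B := by
    letI : Algebra K' ↥B :=
      ((IntermediateField.inclusion (le_sup_left : j'.fieldRange ≤ B)).comp
        (AlgEquiv.ofInjectiveField j').toAlgHom).toRingHom.toAlgebra
    exact isTotallyComplex_of_algebra (F := K') ↥B
  -- a generator of `Gal(B/A) ≅ C₂`
  obtain ⟨σ, hσ⟩ := IsCyclic.exists_generator (α := ↥B ≃ₐ[↥A] ↥B)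
  have hcard : Fintype.card (↥B ≃ₐ[↥A] ↥B) = 2 := by
    rw [← Nat.card_eq_fintype_card, IsGalois.card_aut_eq_finrank, hdegAB]
  have hσ2 : σ * σ = 1 := by rw [← pow_two, ← hcard, pow_card_eq_one]
  -- module (L): Chevalley as a `2`-adic inequality on this layer
  have hchev := padicValNat_two_card_fixed_add_one_le_of_signVec_surjective (K := ↥A) (L := ↥B) hdegAB (hsig n) hσ
  have htn : {v : HeightOneSpectrum (𝓞 ↥A) | v.asIdeal.ramificationIdxIn (𝓞 ↥B) ≠ 1}.ncard ≤ T := hram n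
  -- the action on `Cl(B)` and its fixed classes
  set f : ClassGroup (𝓞 ↥B) ≃* ClassGroup (𝓞 ↥B) := ClassGroup.mulEquiv (intAut σ) with hf
  have hfixed : Nat.card {c : ClassGroup (𝓞 ↥B) // ∀ τ : ↥B ≃ₐ[↥A] ↥B, ClassGroup.mulEquiv (intAut τ) c = c} =
      Nat.card (f.toMonoidHom.eqLocus (MonoidHom.id _)) :=
    natCard_fixed_eq_natCard_eqLocus_of_generator (fun τ : ↥B ≃ₐ[↥A] ↥B ↦ ClassGroup.mulEquiv (intAut τ))
      mulEquiv_intAut_one mulEquiv_intAut_mul hσ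
  have hff : ∀ b : ClassGroup (𝓞 ↥B), (⇑f.toMonoidHom)^[2] b = b := fun b ↦ by
    rw [Function.iterate_succ_apply, Function.iterate_one, MulEquiv.coe_toMonoidHom, hf, ← MulEquiv.trans_apply,
      ← mulEquiv_intAut_mul, hσ2, mulEquiv_intAut_one, MulEquiv.refl_apply]
  -- module (G): the rank bound
  have hNj : ∀ a : ClassGroup (𝓞 ↥A), classGroupNorm ↥A ↥B (classGroupExtend ↥A ↥B a) = a ^ 2 := fun a ↦ by
    rw [classGroupNorm_classGroupExtend, hdegAB]
  have hjfix : ∀ a : ClassGroup (𝓞 ↥A), f.toMonoidHom (classGroupExtend ↥A ↥B a) = classGroupExtend ↥A ↥B a := fun a ↦ by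
    rw [MulEquiv.coe_toMonoidHom, hf, mulEquiv_intAut_classGroupExtend]
  have hfix : padicValNat 2 (Nat.card (f.toMonoidHom.eqLocus (MonoidHom.id _))) ≤
      padicValNat 2 (Nat.card (ClassGroup (𝓞 ↥A))) + T := by
    rw [← hfixed]
    have hcl : classNumber ↥A = Nat.card (ClassGroup (𝓞 ↥A)) := by
      rw [classNumber, Nat.card_eq_fintype_card]
    rw [← hcl]
    omega
  have hrank := padicValNat_card_quotient_le_of_fixed 2 f.toMonoidHom hff (classGroupExtend ↥A ↥B) (classGroupNorm ↥A ↥B)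
    hNj hjfix T hfix
  -- transport to the layers of the restricted towers
  rw [classGroupPRank_restrict_eq κ K' hK' j' n]
  have hRn := hR n
  rw [classGroupPRank_restrict_eq κ K hK j n] at hRn
  calc padicValNat 2 (Nat.card (ClassGroup (𝓞 ↥B) ⧸ (powMonoidHom 2 : ClassGroup (𝓞 ↥B) →* _).range))
      ≤ 2 * (2 * padicValNat 2 (Nat.card (ClassGroup (𝓞 ↥A) ⧸ (powMonoidHom 2 : ClassGroup (𝓞 ↥A) →* _).range)) + T) := hrank
    _ ≤ 2 * (2 * R + T) := by
        apply Nat.mul_le_mul_left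
        exact Nat.add_le_add_right (Nat.mul_le_mul_left 2 hRn) T

end Literature.NumberTheory.IwasawaTheory

end
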